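import Mathlib.Data.Finset.SymmDiff
import Summits.CriticalPhenomena.Ising3DConformalLimit.Theorems.HyperoctahedralRPExistsScaleCovariantLimitBlockCovAlgebra
import Summits.CriticalPhenomena.Ising3DConformalLimit.Theorems.HyperoctahedralRPExistsScaleCovariantLimitBlockCovTwoPointBounds
import HarnessLib

/-!
# Slab variance: two-point mass of the symmetric difference of two nearby blocks
(line `Sketch` of crux `JoiningsTransfer`, stmt-CriticalPhenomena-18764, route SynchronousCoupling;
stub `stub_slabVariance`, E2)

With `G = ⟨σ₀σ_z⟩_{β_c} = criticalTwoPoint 3` the critical two-point function of the n.n. Ising model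
on `ℤ³`, `V(L) = blockCov L 0` the block variance and `S(R) = Σ_{z ∈ box 3 R} G z`:
for the two blocks `Q = cube L + L•k`, `Q' = cube L' + L'•k` of sides `L ≤ L' ≤ (1+s)L` at block
position `k ∈ ℤ³` and `D = Q' ∆ Q` their symmetric difference,

  `Σ_{x,y ∈ D} G(y − x) ≤ ε V(L)`   for `L ≥ L₀`, once `s = s(k, ε)` is small,

GIVEN the ball-sum ratio bound `L³ S(cL) ≤ A_c V(L)` eventually (stub E1's conclusion, a hypothesis
here). Pure lattice bookkeeping:
* every `z ∈ Q ∪ Q'` has coordinates in `[L kᵢ − E, L kᵢ + L' + E)` with `E = (L'−L) K`,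
  `K = ‖k‖_∞`, so every row `Σ_{y ∈ D} G(y − x)`, `x ∈ D`, is at most `S(3L)` (`L' ≤ 2L`, `2E ≤ L`);
* the box `Π_i [L kᵢ + E, L kᵢ + L − E)` lies in `Q ∩ Q'`, so
  `#D ≤ L'³ + L³ − 2(L − 2E)³ ≤ ((1+s)³ + 1 − 2(1 − 2sK)³) L³ ≤ s(12K + 7) L³`;
* hence `Σ_{x,y ∈ D} G(y−x) ≤ #D · S(3L) ≤ s(12K+7) · L³ S(3L) ≤ s(12K+7) |A| V(L) ≤ ε V(L)`.

No named facts. [folklore]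
-/

noncomputable section

namespace Summit.CriticalPhenomena.Ising3DConformalLimit.Cruxes.JoiningsTransfer.Sketch

open Literature.Probability.LatticeModels Filter Set
open scoped Topology BigOperators
open Summit.CriticalPhenomena.Ising3DConformalLimit.Cruxes.ExistsScaleCovariantLimit.MonotoneBlockingPort

/-! ## Coordinates of block points -/

/-- A point of the block `cube L + L•k` has coordinates in `[L kᵢ, L kᵢ + L)`. [folklore] -/
private theorem stub_slabVariance_coord_block {L : ℕ} {k z : Site 3}
    (hz : z ∈ (cube L).image (fun x => x + (L : ℤ) • k)) (i : Fin 3) :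
    (L : ℤ) * k i ≤ z i ∧ z i < (L : ℤ) * k i + L := by
  rw [Finset.mem_image] at hz
  obtain ⟨x, hx, rfl⟩ := hz
  rw [mem_cube] at hx
  obtain ⟨h1, h2⟩ := hx i
  simp only [Pi.add_apply, Pi.smul_apply, smul_eq_mul]
  constructor <;> linarith

/-- `|(L' − L) kᵢ| ≤ (L' − L) K` when `|kᵢ| ≤ K` and `L ≤ L'`. [folklore] -/
private theorem stub_slabVariance_dev {K L L' : ℕ} {k : Site 3} (hK : ∀ i, |k i| ≤ (K : ℤ))
    (hLL' : L ≤ L') (i : Fin 3) :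
    |((L' : ℤ) - L) * k i| ≤ (((L' - L) * K : ℕ) : ℤ) := by
  have h0 : (0 : ℤ) ≤ (L' : ℤ) - L := by omega
  rw [abs_mul, abs_of_nonneg h0]
  push_cast [Nat.cast_sub hLL']
  exact mul_le_mul_of_nonneg_left (hK i) h0

/-- Points of `Q' ∪ Q` have coordinates in `[L kᵢ − E, L kᵢ + L' + E)` once `|(L' − L) kᵢ| ≤ E`.
[folklore] -/
private theorem stub_slabVariance_coord_union {L L' E : ℕ} {k z : Site 3} (hLL' : L ≤ L')
    (hdev : ∀ i, |((L' : ℤ) - L) * k i| ≤ (E : ℤ))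
    (hz : z ∈ (cube L').image (fun x => x + (L' : ℤ) • k) ∪ (cube L).image (fun x => x + (L : ℤ) • k))
    (i : Fin 3) :
    (L : ℤ) * k i - E ≤ z i ∧ z i < (L : ℤ) * k i + L' + E := by
  obtain ⟨hd1, hd2⟩ := abs_le.mp (hdev i)
  have hL : (L : ℤ) ≤ L' := by exact_mod_cast hLL'
  have hE : (0 : ℤ) ≤ E := Nat.cast_nonneg _
  rw [Finset.mem_union] at hz
  rcases hz with hz | hz
  · obtain ⟨h1, h2⟩ := stub_slabVariance_coord_block hz i
    constructor <;> linarith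
  · obtain ⟨h1, h2⟩ := stub_slabVariance_coord_block hz i
    constructor <;> linarith

/-- For `x, y ∈ Q' ∪ Q`: `y − x ∈ box 3 (3L)` (using `L' ≤ 2L` and `2E ≤ L`). [folklore] -/
private theorem stub_slabVariance_sub_mem_box {L L' E : ℕ} {k x y : Site 3} (hLL' : L ≤ L')
    (hL'2 : L' ≤ 2 * L) (h2E : 2 * E ≤ L) (hdev : ∀ i, |((L' : ℤ) - L) * k i| ≤ (E : ℤ))
    (hx : x ∈ (cube L').image (fun x => x + (L' : ℤ) • k) ∪ (cube L).image (fun x => x + (L : ℤ) • k))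
    (hy : y ∈ (cube L').image (fun x => x + (L' : ℤ) • k) ∪ (cube L).image (fun x => x + (L : ℤ) • k)) :
    y - x ∈ box 3 (3 * L) := by
  rw [mem_box]
  intro i
  obtain ⟨hx1, hx2⟩ := stub_slabVariance_coord_union hLL' hdev hx i
  obtain ⟨hy1, hy2⟩ := stub_slabVariance_coord_union hLL' hdev hy i
  have h1 : (L' : ℤ) ≤ 2 * L := by exact_mod_cast hL'2
  have h2 : 2 * (E : ℤ) ≤ L := by exact_mod_cast h2E
  simp only [Pi.sub_apply]
  push_cast
  constructor <;> linarith

/-! ## Row sums -/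

/-- If every `y − x`, `y ∈ D`, lies in `box 3 R`, then `Σ_{y ∈ D} G(y − x) ≤ S(R)` (reindex `y ↦ y − x`
injectively; the terms are `≥ 0`). [folklore] -/
private theorem stub_slabVariance_row_le {R : ℕ} {D : Finset (Site 3)} {x : Site 3}
    (h : ∀ y ∈ D, y - x ∈ box 3 R) :
    ∑ y ∈ D, criticalTwoPoint 3 (y - x) ≤ ∑ z ∈ box 3 R, criticalTwoPoint 3 z := by
  have hsub : D.image (fun y => y - x) ⊆ box 3 R := by
    intro z hz
    rw [Finset.mem_image] at hz
    obtain ⟨y, hy, rfl⟩ := hz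
    exact h y hy
  calc ∑ y ∈ D, criticalTwoPoint 3 (y - x)
      = ∑ z ∈ D.image (fun y => y - x), criticalTwoPoint 3 z :=
        (Finset.sum_image fun a _ b _ hab => sub_left_injective hab).symm
    _ ≤ ∑ z ∈ box 3 R, criticalTwoPoint 3 z :=
        Finset.sum_le_sum_of_subset_of_nonneg hsub fun z _ _ => criticalTwoPoint_nonneg' z

/-- `Σ_{x,y ∈ D} G(y − x) ≤ #D · S(R)` when all differences lie in `box 3 R`. [folklore] -/
private theorem stub_slabVariance_double_le {R : ℕ} {D : Finset (Site 3)}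
    (h : ∀ x ∈ D, ∀ y ∈ D, y - x ∈ box 3 R) :
    ∑ x ∈ D, ∑ y ∈ D, criticalTwoPoint 3 (y - x) ≤
      (D.card : ℝ) * ∑ z ∈ box 3 R, criticalTwoPoint 3 z := by
  calc ∑ x ∈ D, ∑ y ∈ D, criticalTwoPoint 3 (y - x)
      ≤ ∑ _x ∈ D, ∑ z ∈ box 3 R, criticalTwoPoint 3 z :=
        Finset.sum_le_sum fun x hx => stub_slabVariance_row_le (h x hx)
    _ = (D.card : ℝ) * ∑ z ∈ box 3 R, criticalTwoPoint 3 z := by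
        rw [Finset.sum_const, nsmul_eq_mul]

/-! ## Cardinality of the symmetric difference -/

/-- `#(cube L + L•k) = L³`. [folklore] -/
private theorem stub_slabVariance_card_block (L : ℕ) (k : Site 3) :
    ((cube L).image (fun x => x + (L : ℤ) • k)).card = L ^ 3 := by
  rw [Finset.card_image_of_injective _ (add_left_injective _), card_cube]

/-- The inner box `Π_i [L kᵢ + E, L kᵢ + L − E)` lies in `Q' ∩ Q`. [folklore] -/
private theorem stub_slabVariance_inner_subset {L L' E : ℕ} {k : Site 3} (hLL' : L ≤ L')
    (hdev : ∀ i, |((L' : ℤ) - L) * k i| ≤ (E : ℤ)) :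
    (Fintype.piFinset fun i => Finset.Ico ((L : ℤ) * k i + E) ((L : ℤ) * k i + L - E)) ⊆
      (cube L').image (fun x => x + (L' : ℤ) • k) ∩ (cube L).image (fun x => x + (L : ℤ) • k) := by
  intro z hz
  rw [Fintype.mem_piFinset] at hz
  have hL : (L : ℤ) ≤ L' := by exact_mod_cast hLL'
  have hE : (0 : ℤ) ≤ E := Nat.cast_nonneg _
  rw [Finset.mem_inter, Finset.mem_image, Finset.mem_image]
  refine ⟨⟨z - (L' : ℤ) • k, ?_, sub_add_cancel _ _⟩, ⟨z - (L : ℤ) • k, ?_, sub_add_cancel _ _⟩⟩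
  · rw [mem_cube]
    intro i
    have h := hz i
    rw [Finset.mem_Ico] at h
    obtain ⟨hd1, hd2⟩ := abs_le.mp (hdev i)
    simp only [Pi.sub_apply, Pi.smul_apply, smul_eq_mul]
    constructor <;> linarith
  · rw [mem_cube]
    intro i
    have h := hz i
    rw [Finset.mem_Ico] at h
    simp only [Pi.sub_apply, Pi.smul_apply, smul_eq_mul]
    constructor <;> linarith

/-- The inner box has `(L − 2E)³` points (when `2E ≤ L`). [folklore] -/
private theorem stub_slabVariance_card_inner {L E : ℕ} (k : Site 3) (h2E : 2 * E ≤ L) :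
    (Fintype.piFinset fun i => Finset.Ico ((L : ℤ) * k i + E) ((L : ℤ) * k i + L - E)).card =
      (L - 2 * E) ^ 3 := by
  rw [Fintype.card_piFinset, Finset.prod_eq_pow_card (b := L - 2 * E)]
  · simp
  · intro i _
    rw [Int.card_Ico]
    omega

/-- `#(s ∆ t) + 2 #I ≤ #s + #t` for `I ⊆ s ∩ t`. [folklore] -/
private theorem stub_slabVariance_card_symmDiff_add {s t I : Finset (Site 3)} (hI : I ⊆ s ∩ t) :
    (symmDiff s t).card + 2 * I.card ≤ s.card + t.card := by
  have h1 : (symmDiff s t).card = (s \ t).card + (t \ s).card := by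
    rw [Finset.symmDiff_def, Finset.card_union_of_disjoint disjoint_sdiff_sdiff]
  have h2 := Finset.card_sdiff_add_card_inter s t
  have h3 := Finset.card_sdiff_add_card_inter t s
  have h4 := Finset.card_le_card hI
  rw [Finset.inter_comm t s] at h3
  omega

/-- `(1+s)³ + 1 − 2(1−u)³ ≤ 7s + 6u` on `[0,1]²`
(`= s(1−s)(4+s) + 2u²(3−u) ≥ 0` after rearranging). [folklore] -/
private theorem stub_slabVariance_poly {s u : ℝ} (hs0 : 0 ≤ s) (hs1 : s ≤ 1) (hu0 : 0 ≤ u)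
    (hu1 : u ≤ 1) : (1 + s) ^ 3 + 1 - 2 * (1 - u) ^ 3 ≤ 7 * s + 6 * u := by
  have h1 : 0 ≤ s * (1 - s) * (4 + s) :=
    mul_nonneg (mul_nonneg hs0 (sub_nonneg.2 hs1)) (by linarith)
  have h2 : 0 ≤ u * u * (3 - u) := mul_nonneg (mul_nonneg hu0 hu0) (by linarith)
  nlinarith [h1, h2]

/-- `#(Q' ∆ Q) ≤ s(12K+7) L³` in `ℝ`, from `#(Q' ∆ Q) + 2(L − 2E)³ ≤ L'³ + L³`, `L' ≤ (1+s)L`,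
`E ≤ sKL`, `2sK ≤ 1`. [folklore] -/
private theorem stub_slabVariance_card_real {L L' E K : ℕ} {s : ℝ} {Q Q' I : Finset (Site 3)}
    (hI : I ⊆ Q' ∩ Q) (hQ : Q.card = L ^ 3) (hQ' : Q'.card = L' ^ 3)
    (hIc : I.card = (L - 2 * E) ^ 3) (hL's : (L' : ℝ) ≤ (1 + s) * L) (hs0 : 0 ≤ s) (hs1 : s ≤ 1)
    (hsK : 2 * s * K ≤ 1) (h2E : 2 * E ≤ L) (hEle : (E : ℝ) ≤ s * K * L) :
    ((symmDiff Q' Q).card : ℝ) ≤ s * (12 * K + 7) * (L : ℝ) ^ 3 := by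
  have hnat := stub_slabVariance_card_symmDiff_add hI
  rw [hQ, hQ', hIc] at hnat
  have hreal : ((symmDiff Q' Q).card : ℝ) + 2 * ((L : ℝ) - 2 * E) ^ 3 ≤
      (L' : ℝ) ^ 3 + (L : ℝ) ^ 3 := by
    have h : (((symmDiff Q' Q).card + 2 * (L - 2 * E) ^ 3 : ℕ) : ℝ) ≤ ((L' ^ 3 + L ^ 3 : ℕ) : ℝ) := by
      exact_mod_cast hnat
    push_cast [Nat.cast_sub h2E] at h
    linarith
  have hL0 : (0 : ℝ) ≤ L := Nat.cast_nonneg _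
  have hK0 : (0 : ℝ) ≤ K := Nat.cast_nonneg _
  have hlow0 : 0 ≤ (L : ℝ) * (1 - 2 * s * K) := mul_nonneg hL0 (by linarith)
  have hlow : (L : ℝ) * (1 - 2 * s * K) ≤ (L : ℝ) - 2 * E := by nlinarith
  have hlow3 : ((L : ℝ) * (1 - 2 * s * K)) ^ 3 ≤ ((L : ℝ) - 2 * E) ^ 3 :=
    pow_le_pow_left₀ hlow0 hlow 3
  have hup : (L' : ℝ) ^ 3 ≤ ((1 + s) * L) ^ 3 := pow_le_pow_left₀ (Nat.cast_nonneg _) hL's 3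
  have hpoly := stub_slabVariance_poly hs0 hs1 (by positivity : (0 : ℝ) ≤ 2 * s * K) hsK
  calc ((symmDiff Q' Q).card : ℝ)
      ≤ ((1 + s) * L) ^ 3 + (L : ℝ) ^ 3 - 2 * ((L : ℝ) * (1 - 2 * s * K)) ^ 3 := by linarith
    _ = (L : ℝ) ^ 3 * ((1 + s) ^ 3 + 1 - 2 * (1 - 2 * s * K) ^ 3) := by ring
    _ ≤ (L : ℝ) ^ 3 * (7 * s + 6 * (2 * s * K)) := mul_le_mul_of_nonneg_left hpoly (by positivity)
    _ = s * (12 * K + 7) * (L : ℝ) ^ 3 := by ring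

/-! ## Assembly -/

/-- `Σ_{x,y ∈ D} G(y−x) ≤ #D · S(3L) ≤ s(12K+7) L³ S(3L) ≤ s(12K+7) |A| V(L)`. [folklore] -/
private theorem stub_slabVariance_main {K L L' : ℕ} {k : Site 3} {A s : ℝ}
    (hK : ∀ i, |k i| ≤ (K : ℤ)) (hL1 : 1 ≤ L) (hLL' : L ≤ L') (hL's : (L' : ℝ) ≤ (1 + s) * L)
    (hs0 : 0 ≤ s) (hs1 : s ≤ 1) (hsK : 2 * s * K ≤ 1)
    (hA : (L : ℝ) ^ 3 * ∑ z ∈ box 3 (3 * L), criticalTwoPoint 3 z ≤ A * blockCov L 0) :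
    ∑ x ∈ symmDiff ((cube L').image (fun x => x + (L' : ℤ) • k))
        ((cube L).image (fun x => x + (L : ℤ) • k)),
      ∑ y ∈ symmDiff ((cube L').image (fun x => x + (L' : ℤ) • k))
          ((cube L).image (fun x => x + (L : ℤ) • k)),
        criticalTwoPoint 3 (y - x) ≤ s * (12 * K + 7) * |A| * blockCov L 0 := by
  have hV : 0 < blockCov L 0 := blockCov_zero_pos L hL1
  have hL0 : (0 : ℝ) ≤ L := Nat.cast_nonneg _
  have hK0 : (0 : ℝ) ≤ K := Nat.cast_nonneg _
  have hL'2 : L' ≤ 2 * L := by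
    have h1 : s * (L : ℝ) ≤ 1 * L := mul_le_mul_of_nonneg_right hs1 hL0
    have h : (L' : ℝ) ≤ 2 * L := by linarith
    exact_mod_cast h
  have hEle : (((L' - L) * K : ℕ) : ℝ) ≤ s * K * L := by
    push_cast [Nat.cast_sub hLL']
    have h1 : (L' : ℝ) - L ≤ s * L := by linarith
    have h2 := mul_le_mul_of_nonneg_right h1 hK0
    linarith
  have h2E : 2 * ((L' - L) * K) ≤ L := by
    have h1 := mul_le_mul_of_nonneg_right hsK hL0
    have h : (2 : ℝ) * (((L' - L) * K : ℕ) : ℝ) ≤ L := by linarith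
    exact_mod_cast h
  have hdev : ∀ i, |((L' : ℤ) - L) * k i| ≤ (((L' - L) * K : ℕ) : ℤ) :=
    stub_slabVariance_dev hK hLL'
  have hcard := stub_slabVariance_card_real (stub_slabVariance_inner_subset hLL' hdev)
    (stub_slabVariance_card_block L k) (stub_slabVariance_card_block L' k)
    (stub_slabVariance_card_inner k h2E) hL's hs0 hs1 hsK h2E hEle
  have hS0 : 0 ≤ ∑ z ∈ box 3 (3 * L), criticalTwoPoint 3 z :=
    Finset.sum_nonneg fun z _ => criticalTwoPoint_nonneg' z
  have hdouble := stub_slabVariance_double_le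
    (D := symmDiff ((cube L').image (fun x => x + (L' : ℤ) • k))
      ((cube L).image (fun x => x + (L : ℤ) • k))) (R := 3 * L)
    (fun x hx y hy => stub_slabVariance_sub_mem_box hLL' hL'2 h2E hdev
      (Finset.symmDiff_subset_union hx) (Finset.symmDiff_subset_union hy))
  calc _ ≤ _ := hdouble
    _ ≤ s * (12 * K + 7) * (L : ℝ) ^ 3 * ∑ z ∈ box 3 (3 * L), criticalTwoPoint 3 z :=
        mul_le_mul_of_nonneg_right hcard hS0
    _ = s * (12 * K + 7) * ((L : ℝ) ^ 3 * ∑ z ∈ box 3 (3 * L), criticalTwoPoint 3 z) := by ring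
    _ ≤ s * (12 * K + 7) * (|A| * blockCov L 0) :=
        mul_le_mul_of_nonneg_left (hA.trans (mul_le_mul_of_nonneg_right (le_abs_self A) hV.le))
          (by positivity)
    _ = s * (12 * K + 7) * |A| * blockCov L 0 := by ring

/-! ## The stub -/

/-- **Stub E2 — slab variance.** Given the ball-sum ratio bound `L³ S(cL) ≤ A_c V(L)` for large `L`
(stub E1's conclusion), for every block position `k` and `ε > 0` there is `s > 0` such that the
two-point mass of the symmetric difference of the blocks `cube L' + L'•k` and `cube L + L•k`,
`L₀ ≤ L ≤ L' ≤ (1+s)L`, is at most `ε V(L)`: the symmetric difference is a shell of `≤ s(12K+7)L³`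
sites and each of its rows has two-point mass `≤ S(3L)`. [folklore] -/
theorem stub_slabVariance :
    (∀ c : ℕ, ∃ A : ℝ, ∃ L₀ : ℕ, 1 ≤ L₀ ∧ ∀ L : ℕ, L₀ ≤ L →
      (L : ℝ) ^ 3 * ∑ z ∈ box 3 (c * L), criticalTwoPoint 3 z ≤ A * blockCov L 0) →
    ∀ (k : Site 3) (ε : ℝ), 0 < ε → ∃ s : ℝ, 0 < s ∧ ∃ L₀ : ℕ, 1 ≤ L₀ ∧ ∀ L L' : ℕ, L₀ ≤ L → L ≤ L' →
      (L' : ℝ) ≤ (1 + s) * L →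
      ∑ x ∈ symmDiff ((cube L').image (fun x => x + (L' : ℤ) • k)) ((cube L).image (fun x => x + (L : ℤ) • k)),
        ∑ y ∈ symmDiff ((cube L').image (fun x => x + (L' : ℤ) • k)) ((cube L).image (fun x => x + (L : ℤ) • k)),
          criticalTwoPoint 3 (y - x) ≤ ε * blockCov L 0 := by
  intro hball k ε hε
  obtain ⟨K, hK⟩ : ∃ K : ℕ, ∀ i, |k i| ≤ (K : ℤ) :=
    ⟨Site.supNorm k, fun i => by
      rw [Int.abs_eq_natAbs]
      exact_mod_cast Site.natAbs_le_supNorm k i⟩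
  obtain ⟨A, L₁, hL₁, hA⟩ := hball 3
  have hK0 : (0 : ℝ) ≤ K := Nat.cast_nonneg _
  have hden1 : (0 : ℝ) < 2 * K + 2 := by positivity
  have hden2 : (0 : ℝ) < (12 * K + 7) * (|A| + 1) := by positivity
  obtain ⟨s, hs0, hs1, hs2⟩ : ∃ s : ℝ, 0 < s ∧ s ≤ 1 / (2 * K + 2) ∧
      s ≤ ε / ((12 * K + 7) * (|A| + 1)) :=
    ⟨min (1 / (2 * K + 2)) (ε / ((12 * K + 7) * (|A| + 1))),
      lt_min (by positivity) (div_pos hε hden2), min_le_left _ _, min_le_right _ _⟩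
  refine ⟨s, hs0, L₁, hL₁, fun L L' hL hLL' hL's => ?_⟩
  have hL1 : 1 ≤ L := le_trans hL₁ hL
  have hs1' : s * (2 * K + 2) ≤ 1 := (le_div_iff₀ hden1).1 hs1
  have hsK0 : 0 ≤ s * K := mul_nonneg hs0.le hK0
  have hsK : 2 * s * K ≤ 1 := by linarith
  have hs1'' : s ≤ 1 := by linarith
  have hs2' : s * ((12 * K + 7) * (|A| + 1)) ≤ ε := (le_div_iff₀ hden2).1 hs2
  have hV : 0 ≤ blockCov L 0 := (blockCov_zero_pos L hL1).le
  have hfin : s * (12 * K + 7) * |A| ≤ ε := by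
    have h0 : 0 ≤ s * (12 * K + 7) := by positivity
    linarith
  calc _ ≤ s * (12 * K + 7) * |A| * blockCov L 0 :=
        stub_slabVariance_main hK hL1 hLL' hL's hs0.le hs1'' hsK (hA L hL)
    _ ≤ ε * blockCov L 0 := mul_le_mul_of_nonneg_right hfin hV

end Summit.CriticalPhenomena.Ising3DConformalLimit.Cruxes.JoiningsTransfer.Sketch

end
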